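import Literature.MathematicalPhysics.QuantumFieldTheory.Balaban1983to89.B7Prop3FlatRecSide
import Literature.MathematicalPhysics.QuantumFieldTheory.Balaban1983to89.B8Lemma1NonAbelianRecLoops

/-!
# `Balaban1983to89.B7Prop3StaircaseStokesRec` — LATTICE STOKES BETWEEN TWO SHORTEST STAIRCASES ([Balaban1987RG1] (0.3)) AND THE CURVATURE BOUND OF THE FLAT CARRIED LETTER `Φ_A`
# of the record's (124) ([Balaban1985Averaging] Prop. 3 for the averaging structure of [Balaban1987RG1] (0.4); road (A′), the «N2 estimate proper» at the flat background)

statement-level skeleton of published theorems with citation tags; proofs where landed; nothing here is a claim about the Yang–Mills mass gap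

CITATION HEADER (lean-in-tree rule).  Cell `pub-ymgap`, seat `pub-ymgap-dag-n05-e` g36 (N05-REC LEAD PEN); item R1 ([3] layer), road (A′) of director-ym №257∕№265: the N2 ESTIMATE at
the flat background `V₀ = 1`.  `--kind proof --supports stmt-QuantumFields-20541` (K0⁷; count-neutral; no definition).  Sources READ: [I] = [Balaban1987RG1] (0.3)–(0.4) pp. 252–253
(`paper:balaban1987-cmp109-rg-i-small-field`: «take a permutation {π(1), π(2), …} of indices μ with nonzero numbers n_μ, next take |n_{π(1)}| bonds in the direction sign n_{π(1)} e_{π(1)} …»);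
[3] = [Balaban1985Averaging] pp. 24–25 ((47)–(50): the engine's own flat Stokes bookkeeping `B7Prop1Explicit.stokes`, `corner_cancellation`), p. 34 (112), p. 36 (124)–(126); [B5] =
[Balaban1984PropagatorsI] (1.7) p. 18 (the tree staircase, last coordinate first).  REUSED BY NAME: `B7Prop1Explicit.stokes` (flat Stokes on a rectangle), `asum_append`, `asum_seg_neg`;
`B8Lemma1NonAbelian.tw` ∕ `B8Lemma1NonAbelianRecLoops.stairWord_eq_tw` (staircases as run words); `B7Prop3FlatRecSide.PhiZ`, `sum_IdxZ_fst`, `norm_avgZ_le`; `BlockAveragingZd.l1_offZ_le`.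

WHY THIS FILE.  The located point of the N05-REC road (LOCATED-N2, memos `HOME/pub-ymgap-dag-n05-e/LOCATED-N2-*.md`): the record's linearised one-step average differs from the engine-shaped
one by the coarse gauge term generated by `λ_A(y) = mean_{(r,σ)}[(R_{0,y}A)(Γ^σ_{y,x}) − (R_{0,y}A)(Γ_{y,x})]` (`B7Prop3GaugeCarryRec.lamZ`; at `V₀ = 1` it is `Φ_A = PhiZ`), which is NOT small in
`sup|A|` but IS small in the curvature of `A`: the two staircases `Γ^σ_{y,x}`, `Γ_{y,x}` have the same end points, so their difference is a lattice-Stokes sum of plaquette curls `(dA)(p) =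
A(∂p)` over a surface of at most `|x − y|₁²` plaquettes.  This file proves exactly that, at the flat background, in the engine's abelian-linear letters (`asum`): the curvature bound that
the road's (1.56)-data step consumes (SOCKET-CHECK-N2.md: the carried letter is absorbed on the DATA side, bounded by the plaquette smallness the premise `HThm4Rec` already carries).
WHAT IS PROVED (sorry-free; `M` = a bound of `‖A(∂p)‖ = ‖asum A x (plaqWord μ ν)‖` over all plaquettes).  §1 `norm_asum_rectWord_le` (`‖A(∂[rectangle n×m])‖ ≤ n·m·M`, from the engine's
`stokes`); the TWO-RUN SWAP `asum_swap_runs_eq_rect_*` (four sign cases: `A(run_μ(a) ∪ run_ν(b)) − A(run_ν(b) ∪ run_μ(a)) = ±A(∂ rectangle)`) and ★`norm_asum_swap_runs_le` (`≤ |a|·|b|·M` for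
all integers `a, b`); §2 run words through a list of axes (`tw`): ★`norm_asum_tw_moveFront_le` (moving one run to the front past runs of total length `S` costs `|n_a|·S·M`),
★★`norm_asum_tw_perm_le` (two staircases through PERMUTED axis lists differ by at most `S²·M`, `S` = total run length — selection-sort induction on `List.Perm`); §3 ★★`norm_asum_stairWord_sub_treeWord_le`
(`‖A(Γ^σ_{y,x}) − A(Γ_{y,x})‖ ≤ |x−y|₁²·M` for every ordering `σ` of (0.3)), `PhiZ_eq_mean`, ★★★`norm_PhiZ_le` (`‖Φ_A(y)‖ ≤ (d·s)²·M` on centred blocks of side `L = 2s+1`) and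
`norm_PhiZ_sub_le` (the flat carried gauge term of one `L`-bond: `‖Φ_A(c₋) − Φ_A(c₊)‖ ≤ 2(d·s)²·M`).
HONEST SCOPE.  Finite abelian-linear lattice bookkeeping at the FLAT background only (the covariant version at a regular background, with the `O(α₀)·|A|` holonomy corrections, is the
sequel's); nothing of [3]∕[6]∕[I] asserted; `HThm4Rec` UNDISCHARGED; N05 discharged of record untouched; N07 not claimable; counts unmoved (typed 28∕28 · discharged 8∕28); one finite 𝕋⁴
programme at fixed ε — nothing continuum ∕ ℝ⁴ ∕ OS ∕ mass gap ∕ Clay.  No `def`, no `instance`, no `notation`, no `sorry`.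
-/

set_option autoImplicit false

noncomputable section

open scoped BigOperators
open Finset

namespace Literature.MathematicalPhysics.QuantumFieldTheory.Balaban1983to89.B7Prop3StaircaseStokesRec

open B7Prop1Explicit hiding Site
open B7Prop1Explicit renaming Site → SiteZ
open B8Lemma1NonAbelian (tw tw_nil tw_cons treeWord_eq_tw)
open B8Lemma1NonAbelianRecLoops (stairWord_eq_tw)
open BlockAveragingZd (offZ IdxZ l1_offZ_le)
open B7SectEFLinearisationRec (FhatZ)
open B7Prop3FlatRecSide (SZ PhiZ sum_IdxZ_fst norm_avgZ_le)
open T4Continuum (stairWord)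

variable {d : ℕ}

variable {𝔸 : Type*} [NormedRing 𝔸]

/-! ## §1 One rectangle: flat Stokes, and the two-run swap in all four sign cases -/

section Rect

variable (A : SiteZ d → Fin d → 𝔸) {M : ℝ} (y : SiteZ d) (R : ℕ)
  (hM : ∀ (x : SiteZ d) (μ ν : Fin d), l1 (x - y) ≤ R → ‖asum A x (plaqWord μ ν)‖ ≤ M)

include hM in
/-- **`‖A(∂[p; n e_μ × m e_ν])‖ ≤ n·m·M`** when every plaquette of the rectangle lies within `|·|₁`-distance `R` of the root `y` where the curl bound `M` holds — the flat Stokes sum of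
the engine (`B7Prop1Explicit.stokes`: the boundary sum of an `n × m` rectangle is the sum of its `n·m` plaquette curls) in norm. [cite: Balaban1985Averaging, (48)–(50) pp.24–25] -/
theorem norm_asum_rectWord_le (p : SiteZ d) (n m : ℕ) (μ ν : Fin d)
    (hloc : ∀ i < n, ∀ j < m, l1 (p + (i : ℤ) • e μ + (j : ℤ) • e ν - y) ≤ R) :
    ‖asum A p (rectWord n m μ ν)‖ ≤ n * m * M := by
  rw [stokes]
  calc ‖∑ i ∈ Finset.range n, ∑ j ∈ Finset.range m, asum A (p + (i : ℤ) • e μ + (j : ℤ) • e ν) (plaqWord μ ν)‖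
      ≤ ∑ i ∈ Finset.range n, ‖∑ j ∈ Finset.range m, asum A (p + (i : ℤ) • e μ + (j : ℤ) • e ν) (plaqWord μ ν)‖ := norm_sum_le _ _
    _ ≤ ∑ i ∈ Finset.range n, ∑ j ∈ Finset.range m, M :=
        Finset.sum_le_sum fun i hi => (norm_sum_le _ _).trans (Finset.sum_le_sum fun j hj =>
          hM _ _ _ (hloc i (Finset.mem_range.mp hi) j (Finset.mem_range.mp hj)))
    _ = n * m * M := by simp [Finset.sum_const, Finset.card_range]; ring

/-- Two runs as one appended word: `A(run_μ(a) ∪ run_ν(b)) = A(run_μ(a)) + A(run_ν(b))` from the shifted base point. [cite: Balaban1987RG1, (0.3) p.252] -/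
theorem asum_two_runs (p : SiteZ d) (μ ν : Fin d) (a b : ℤ) :
    asum A p (seg μ a ++ seg ν b) = asum A p (seg μ a) + asum A (p + a • e μ) (seg ν b) := by
  rw [asum_append, disp_seg]

/-- The boundary sum of the rectangle as its four sides: `A(∂[p; n × m]) = A_μ(p) + A_ν(p + n e_μ) − A_μ(p + m e_ν) − A_ν(p)` (`A_κ(x)` = the run of `κ` from `x`).
[cite: Balaban1985Averaging, (48) p.25] -/
theorem asum_rectWord_eq (p : SiteZ d) (n m : ℕ) (μ ν : Fin d) :
    asum A p (rectWord n m μ ν) = asum A p (seg μ n) + asum A (p + (n : ℤ) • e μ) (seg ν m)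
      - asum A (p + (m : ℤ) • e ν) (seg μ n) - asum A p (seg ν m) := by
  unfold rectWord
  rw [asum_append, asum_append, asum_append]
  simp only [disp_append, disp_seg]
  rw [asum_seg_neg, asum_seg_neg]
  have h1 : p + ((n : ℤ) • e μ + (m : ℤ) • e ν) - (n : ℤ) • e μ = p + (m : ℤ) • e ν := by abel
  have h2 : p + ((n : ℤ) • e μ + (m : ℤ) • e ν + -(n : ℤ) • e μ) - (m : ℤ) • e ν = p := by rw [neg_smul]; abel
  rw [h1, h2]
  abel

/-- Two-run swap, case `a = n ≥ 0`, `b = m ≥ 0`: `A(run_μ(n) ∪ run_ν(m)) − A(run_ν(m) ∪ run_μ(n)) = A(∂[p; n × m])`. [cite: Balaban1985Averaging, (48) p.25; Balaban1987RG1, (0.3) p.252] -/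
theorem asum_swap_runs_eq_rect_pos_pos (p : SiteZ d) (n m : ℕ) (μ ν : Fin d) :
    asum A p (seg μ n ++ seg ν m) - asum A p (seg ν m ++ seg μ n) = asum A p (rectWord n m μ ν) := by
  rw [asum_two_runs, asum_two_runs, asum_rectWord_eq]
  abel

/-- Two-run swap, case `a = −k ≤ 0`, `b = m ≥ 0`: the difference is MINUS the rectangle based at `p − k e_μ`. [cite: Balaban1985Averaging, (48) p.25; Balaban1987RG1, (0.3) p.252] -/
theorem asum_swap_runs_eq_rect_neg_pos (p : SiteZ d) (k m : ℕ) (μ ν : Fin d) :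
    asum A p (seg μ (-(k : ℤ)) ++ seg ν m) - asum A p (seg ν m ++ seg μ (-(k : ℤ)))
      = -asum A (p - (k : ℤ) • e μ) (rectWord k m μ ν) := by
  rw [asum_two_runs, asum_two_runs, asum_rectWord_eq, asum_seg_neg, asum_seg_neg]
  have h1 : p + -(k : ℤ) • e μ = p - (k : ℤ) • e μ := by rw [neg_smul]; abel
  have h2 : p + (m : ℤ) • e ν - (k : ℤ) • e μ = p - (k : ℤ) • e μ + (m : ℤ) • e ν := by abel
  have h3 : p - (k : ℤ) • e μ + (k : ℤ) • e μ = p := by abel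
  rw [h1, h2, h3]
  abel

/-- Two-run swap, case `a = −k ≤ 0`, `b = −j ≤ 0`: the difference is the rectangle based at `p − k e_μ − j e_ν`. [cite: Balaban1985Averaging, (48) p.25; Balaban1987RG1, (0.3) p.252] -/
theorem asum_swap_runs_eq_rect_neg_neg (p : SiteZ d) (k j : ℕ) (μ ν : Fin d) :
    asum A p (seg μ (-(k : ℤ)) ++ seg ν (-(j : ℤ))) - asum A p (seg ν (-(j : ℤ)) ++ seg μ (-(k : ℤ)))
      = asum A (p - (k : ℤ) • e μ - (j : ℤ) • e ν) (rectWord k j μ ν) := by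
  rw [asum_two_runs, asum_two_runs, asum_rectWord_eq, asum_seg_neg, asum_seg_neg, asum_seg_neg, asum_seg_neg]
  have h1 : p + -(k : ℤ) • e μ - (j : ℤ) • e ν = p - (k : ℤ) • e μ - (j : ℤ) • e ν := by rw [neg_smul]; abel
  have h2 : p + -(j : ℤ) • e ν - (k : ℤ) • e μ = p - (k : ℤ) • e μ - (j : ℤ) • e ν := by rw [neg_smul]; abel
  have h3 : p - (j : ℤ) • e ν = p - (k : ℤ) • e μ - (j : ℤ) • e ν + (k : ℤ) • e μ := by abel
  have h4 : p - (k : ℤ) • e μ = p - (k : ℤ) • e μ - (j : ℤ) • e ν + (j : ℤ) • e ν := by abel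
  rw [h1, h2, ← h3, ← h4]
  abel

omit [NormedRing 𝔸] in
/-- Locality bookkeeping: a plaquette of the rectangle swept by two runs from `p` lies within `|p − y|₁ + |v|₁ + |c₁| + |c₂|` of the root. [cite: Balaban1987RG1, (0.3) p.252] -/
theorem l1_rect_point_le (p v : SiteZ d) (c₁ c₂ : ℤ) (μ ν : Fin d) :
    l1 (p + v + c₁ • e μ + c₂ • e ν - y) ≤ l1 (p - y) + l1 v + c₁.natAbs + c₂.natAbs := by
  have h : p + v + c₁ • e μ + c₂ • e ν - y = (p - y) + v + c₁ • e μ + c₂ • e ν := by abel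
  rw [h]
  refine (l1_add_le _ _).trans ?_
  rw [l1_zsmul_e]
  refine Nat.add_le_add_right ((l1_add_le _ _).trans ?_) _
  rw [l1_zsmul_e]
  exact Nat.add_le_add_right (l1_add_le _ _) _

omit [NormedRing 𝔸] in
/-- Locality of the rectangle's plaquettes, the form used below: base `p + c₁ e_μ + c₂ e_ν`, offsets `i < n`, `j < m` with `|c₁| , |c₁ + n| ≤ n`-type control supplied by `omega`.
[cite: Balaban1987RG1, (0.3) p.252] -/
theorem l1_rect_plaq_le (p : SiteZ d) (c₁ c₂ i j : ℤ) (μ ν : Fin d) :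
    l1 (p + c₁ • e μ + c₂ • e ν + i • e μ + j • e ν - y) ≤ l1 (p - y) + (c₁ + i).natAbs + (c₂ + j).natAbs := by
  have h : p + c₁ • e μ + c₂ • e ν + i • e μ + j • e ν - y = p + 0 + (c₁ + i) • e μ + (c₂ + j) • e ν - y := by
    rw [add_smul, add_smul, add_zero]; abel
  rw [h]
  have h2 := l1_rect_point_le y p 0 (c₁ + i) (c₂ + j) μ ν
  have h0 : l1 (0 : SiteZ d) = 0 := by simp [l1]
  rw [h0, add_zero] at h2
  simpa only [add_zero] using h2

include hM in
/-- ★ **THE TWO-RUN SWAP IN NORM, ALL SIGNS**: for integers `a, b` and axes `μ, ν`, `‖A(run_μ(a) ∪ run_ν(b)) − A(run_ν(b) ∪ run_μ(a))‖ ≤ |a|·|b|·M` — the two paths bound a rectangle of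
`|a|·|b|` plaquettes (flat Stokes), all within `|p − y|₁ + |a| + |b| ≤ R` of the root. [cite: Balaban1985Averaging, (48)–(50) pp.24–25; Balaban1987RG1, (0.3) p.252] -/
theorem norm_asum_swap_runs_le (p : SiteZ d) (a b : ℤ) (μ ν : Fin d) (hloc : l1 (p - y) + a.natAbs + b.natAbs ≤ R) :
    ‖asum A p (seg μ a ++ seg ν b) - asum A p (seg ν b ++ seg μ a)‖ ≤ a.natAbs * b.natAbs * M := by
  obtain ⟨n, rfl | rfl⟩ := Int.eq_nat_or_neg a <;> obtain ⟨m, rfl | rfl⟩ := Int.eq_nat_or_neg b <;>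
    simp only [Int.natAbs_neg, Int.natAbs_natCast] at hloc ⊢
  · rw [asum_swap_runs_eq_rect_pos_pos]
    refine norm_asum_rectWord_le A y R hM p n m μ ν fun i hi j hj => ?_
    have h := l1_rect_plaq_le y p 0 0 (i : ℤ) (j : ℤ) μ ν
    simp only [zero_smul, add_zero, zero_add, Int.natAbs_natCast] at h
    omega
  · -- antisymmetry: exchange the roles of the two runs
    rw [← norm_neg, neg_sub, asum_swap_runs_eq_rect_neg_pos, norm_neg]
    calc ‖asum A (p - (m : ℤ) • e ν) (rectWord m n ν μ)‖ ≤ (m : ℝ) * n * M := by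
          refine norm_asum_rectWord_le A y R hM _ m n ν μ fun i hi j hj => ?_
          have h := l1_rect_plaq_le y p (-(m : ℤ)) 0 (i : ℤ) (j : ℤ) ν μ
          rw [neg_smul, zero_smul, add_zero, ← sub_eq_add_neg] at h
          have h3 : (-(m : ℤ) + i).natAbs ≤ m := by omega
          have h4 : ((0 : ℤ) + j).natAbs ≤ n := by omega
          omega
      _ = (n : ℝ) * m * M := by ring
  · rw [asum_swap_runs_eq_rect_neg_pos, norm_neg]
    refine norm_asum_rectWord_le A y R hM (p - (n : ℤ) • e μ) n m μ ν fun i hi j hj => ?_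
    have h := l1_rect_plaq_le y p (-(n : ℤ)) 0 (i : ℤ) (j : ℤ) μ ν
    rw [neg_smul, zero_smul, add_zero, ← sub_eq_add_neg] at h
    have h3 : (-(n : ℤ) + i).natAbs ≤ n := by omega
    have h4 : ((0 : ℤ) + j).natAbs ≤ m := by omega
    omega
  · rw [asum_swap_runs_eq_rect_neg_neg]
    refine norm_asum_rectWord_le A y R hM (p - (n : ℤ) • e μ - (m : ℤ) • e ν) n m μ ν fun i hi j hj => ?_
    have h := l1_rect_plaq_le y p (-(n : ℤ)) (-(m : ℤ)) (i : ℤ) (j : ℤ) μ ν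
    rw [neg_smul, neg_smul, ← sub_eq_add_neg, ← sub_eq_add_neg] at h
    have h3 : (-(n : ℤ) + i).natAbs ≤ n := by omega
    have h4 : (-(m : ℤ) + j).natAbs ≤ m := by omega
    omega

end Rect

/-! ## §2 Staircases through a list of axes (`tw`): moving one run to the front; permuted axis lists -/

section Perm

omit [NormedRing 𝔸] in
/-- The total run length `S(ks) = Σ_{κ ∈ ks} |n_κ|` of the staircase `tw ks n` (written out as a list sum; for an ordering of all `d` axes it is `|n|₁`) — cons rule. [cite: Balaban1987RG1, (0.3) p.252] -/
theorem runLen_cons (n : SiteZ d) (κ : Fin d) (ks : List (Fin d)) :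
    ((κ :: ks).map fun c => (n c).natAbs).sum = (n κ).natAbs + (ks.map fun c => (n c).natAbs).sum := by
  simp

omit [NormedRing 𝔸] in
/-- The total run length of an append. [cite: Balaban1987RG1, (0.3) p.252] -/
theorem runLen_append (n : SiteZ d) (ks ks' : List (Fin d)) :
    ((ks ++ ks').map fun c => (n c).natAbs).sum = (ks.map fun c => (n c).natAbs).sum + (ks'.map fun c => (n c).natAbs).sum := by
  simp

omit [NormedRing 𝔸] in
/-- For an ordering `σ` of all the axes the total run length is `|n|₁` («shortest contours», [Balaban1987RG1] p. 252). [cite: Balaban1987RG1, (0.3) p.252] -/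
theorem runLen_finRange_map (n : SiteZ d) (σ : Equiv.Perm (Fin d)) : (((List.finRange d).map σ).map fun c => (n c).natAbs).sum = l1 n := by
  unfold l1
  rw [List.map_map, ← Equiv.sum_comp σ (fun c => (n c).natAbs), Fin.sum_univ_def]
  rfl

omit [NormedRing 𝔸] in
/-- The tree staircase of [Balaban1984PropagatorsI] (1.7) (last coordinate first) also has total run length `|n|₁`. [cite: Balaban1984PropagatorsI, (1.7) p.18] -/
theorem runLen_finRange_reverse (n : SiteZ d) : (((List.finRange d).reverse).map fun c => (n c).natAbs).sum = l1 n := by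
  unfold l1
  rw [List.map_reverse, List.sum_reverse, Fin.sum_univ_def]

variable (A : SiteZ d → Fin d → 𝔸) {M : ℝ} (hM0 : 0 ≤ M) (y : SiteZ d) (R : ℕ)
  (hM : ∀ (x : SiteZ d) (μ ν : Fin d), l1 (x - y) ≤ R → ‖asum A x (plaqWord μ ν)‖ ≤ M)

/-- `A(tw (κ :: ks) n) = A(run_κ(n_κ)) + A(tw ks n)` from the shifted base point. [cite: Balaban1987RG1, (0.3) p.252] -/
theorem asum_tw_cons (p : SiteZ d) (κ : Fin d) (ks : List (Fin d)) (n : SiteZ d) :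
    asum A p (tw (κ :: ks) n) = asum A p (seg κ (n κ)) + asum A (p + n κ • e κ) (tw ks n) := by
  rw [tw_cons, asum_append, disp_seg]

omit [NormedRing 𝔸] in
/-- Locality bookkeeping: after a run of `κ` the base point is at most `|n_κ|` further from the root. [cite: Balaban1987RG1, (0.3) p.252] -/
theorem l1_step_le (p : SiteZ d) (n : SiteZ d) (κ : Fin d) : l1 (p + n κ • e κ - y) ≤ l1 (p - y) + (n κ).natAbs := by
  rw [show p + n κ • e κ - y = (p - y) + n κ • e κ by abel]
  exact (l1_add_le _ _).trans (by rw [l1_zsmul_e])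

include hM in
/-- ★ **MOVING ONE RUN TO THE FRONT**: `‖A(tw (l₁ ++ a :: l₂) n) − A(tw (a :: (l₁ ++ l₂)) n)‖ ≤ |n_a|·S(l₁)·M` — commuting the run of axis `a` past the runs of `l₁` sweeps rectangles of total
area `|n_a|·S(l₁)`, all within `|p − y|₁ + |n_a| + S(l₁) ≤ R` of the root. [cite: Balaban1987RG1, (0.3) p.252; Balaban1985Averaging, (48) p.25] -/
theorem norm_asum_tw_moveFront_le (n : SiteZ d) (a : Fin d) (l₂ : List (Fin d)) :
    ∀ (l₁ : List (Fin d)) (p : SiteZ d), l1 (p - y) + (n a).natAbs + (l₁.map fun c => (n c).natAbs).sum ≤ R →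
      ‖asum A p (tw (l₁ ++ a :: l₂) n) - asum A p (tw (a :: (l₁ ++ l₂)) n)‖ ≤ (n a).natAbs * (l₁.map fun c => (n c).natAbs).sum * M
  | [], p, _ => by simp
  | b :: l₁, p, hloc => by
    rw [runLen_cons] at hloc
    have hstep := l1_step_le y p n b
    have ih := norm_asum_tw_moveFront_le n a l₂ l₁ (p + n b • e b) (by omega)
    -- X − Y: the inductive move behind the run of `b`
    have hXY : ‖asum A p (tw ((b :: l₁) ++ a :: l₂) n) - asum A p (tw (b :: a :: (l₁ ++ l₂)) n)‖
        ≤ (n a).natAbs * (l₁.map fun c => (n c).natAbs).sum * M := by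
      rw [show (b :: l₁) ++ a :: l₂ = b :: (l₁ ++ a :: l₂) from rfl, asum_tw_cons, asum_tw_cons, add_sub_add_left_eq_sub]
      exact ih
    -- Y − Z: the swap of the two front runs
    have hYZ : ‖asum A p (tw (b :: a :: (l₁ ++ l₂)) n) - asum A p (tw (a :: b :: (l₁ ++ l₂)) n)‖
        ≤ (n a).natAbs * (n b).natAbs * M := by
      rw [asum_tw_cons, asum_tw_cons, asum_tw_cons, asum_tw_cons, ← add_assoc, ← add_assoc,
        show p + n b • e b + n a • e a = p + n a • e a + n b • e b by abel, add_sub_add_right_eq_sub,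
        ← asum_two_runs A p b a (n b) (n a), ← asum_two_runs A p a b (n a) (n b), ← norm_neg, neg_sub]
      exact norm_asum_swap_runs_le A y R hM p (n a) (n b) a b (by omega)
    have hsplit' : a :: ((b :: l₁) ++ l₂) = a :: b :: (l₁ ++ l₂) := rfl
    rw [hsplit']
    calc ‖asum A p (tw ((b :: l₁) ++ a :: l₂) n) - asum A p (tw (a :: b :: (l₁ ++ l₂)) n)‖
        ≤ ‖asum A p (tw ((b :: l₁) ++ a :: l₂) n) - asum A p (tw (b :: a :: (l₁ ++ l₂)) n)‖
          + ‖asum A p (tw (b :: a :: (l₁ ++ l₂)) n) - asum A p (tw (a :: b :: (l₁ ++ l₂)) n)‖ :=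
            norm_sub_le_norm_sub_add_norm_sub _ _ _
      _ ≤ (n a).natAbs * (l₁.map fun c => (n c).natAbs).sum * M + (n a).natAbs * (n b).natAbs * M := add_le_add hXY hYZ
      _ = (n a).natAbs * ((b :: l₁).map fun c => (n c).natAbs).sum * M := by rw [runLen_cons]; push_cast; ring

include hM0 hM in
/-- ★★ **TWO STAIRCASES THROUGH PERMUTED AXIS LISTS**: if `ks₁ ~ ks₂` then `‖A(tw ks₁ n) − A(tw ks₂ n)‖ ≤ S(ks₁)²·M` (selection sort: bring the runs of `ks₂` to the front one by one; the
swept area is at most `Σ_a |n_a|·S ≤ S²`, all within `|p − y|₁ + S ≤ R` of the root). [cite: Balaban1987RG1, (0.3) p.252; Balaban1985Averaging, (48)–(50) pp.24–25] -/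
theorem norm_asum_tw_perm_le (n : SiteZ d) :
    ∀ (ks₂ ks₁ : List (Fin d)) (p : SiteZ d), ks₁.Perm ks₂ → l1 (p - y) + (ks₁.map fun c => (n c).natAbs).sum ≤ R →
      ‖asum A p (tw ks₁ n) - asum A p (tw ks₂ n)‖ ≤ (ks₁.map fun c => (n c).natAbs).sum * (ks₁.map fun c => (n c).natAbs).sum * M
  | [], ks₁, p, h, _ => by
    have h0 : ks₁ = [] := List.perm_nil.mp h
    subst h0
    simp
  | a :: ks₂, ks₁, p, h, hloc => by
    have ha : a ∈ ks₁ := h.symm.subset List.mem_cons_self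
    obtain ⟨l₁, l₂, rfl⟩ := List.append_of_mem ha
    have h' : (l₁ ++ l₂).Perm ks₂ := (List.perm_cons a).1 (List.perm_middle.symm.trans h)
    rw [runLen_append, runLen_cons] at hloc
    have hstep := l1_step_le y p n a
    have ih := norm_asum_tw_perm_le n ks₂ (l₁ ++ l₂) (p + n a • e a) h' (by rw [runLen_append]; omega)
    have h1 := norm_asum_tw_moveFront_le A y R hM n a l₂ l₁ p (by omega)
    have h2 : asum A p (tw (a :: (l₁ ++ l₂)) n) - asum A p (tw (a :: ks₂) n)
        = asum A (p + n a • e a) (tw (l₁ ++ l₂) n) - asum A (p + n a • e a) (tw ks₂ n) := by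
      rw [asum_tw_cons, asum_tw_cons, add_sub_add_left_eq_sub]
    have hextra : (0 : ℝ) ≤ ((n a).natAbs : ℝ) * ((l₁.map fun c => (n c).natAbs).sum + 2 * (l₂.map fun c => (n c).natAbs).sum + (n a).natAbs) * M := by positivity
    calc ‖asum A p (tw (l₁ ++ a :: l₂) n) - asum A p (tw (a :: ks₂) n)‖
        ≤ ‖asum A p (tw (l₁ ++ a :: l₂) n) - asum A p (tw (a :: (l₁ ++ l₂)) n)‖
          + ‖asum A p (tw (a :: (l₁ ++ l₂)) n) - asum A p (tw (a :: ks₂) n)‖ := norm_sub_le_norm_sub_add_norm_sub _ _ _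
      _ ≤ (n a).natAbs * (l₁.map fun c => (n c).natAbs).sum * M + ((l₁ ++ l₂).map fun c => (n c).natAbs).sum * ((l₁ ++ l₂).map fun c => (n c).natAbs).sum * M := by
          rw [h2]; exact add_le_add h1 ih
      _ = ((l₁ ++ a :: l₂).map fun c => (n c).natAbs).sum * ((l₁ ++ a :: l₂).map fun c => (n c).natAbs).sum * M
            - ((n a).natAbs : ℝ) * ((l₁.map fun c => (n c).natAbs).sum + 2 * (l₂.map fun c => (n c).natAbs).sum + (n a).natAbs) * M := by
          simp only [runLen_append, runLen_cons]
          push_cast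
          ring
      _ ≤ ((l₁ ++ a :: l₂).map fun c => (n c).natAbs).sum * ((l₁ ++ a :: l₂).map fun c => (n c).natAbs).sum * M := sub_le_self _ hextra

end Perm

/-! ## §3 The two staircases of (0.3) vs (1.7), and the curvature bound of `Φ_A` -/

section Phi

variable (A : SiteZ d → Fin d → 𝔸) {M : ℝ} (hM0 : 0 ≤ M) (y : SiteZ d) (R : ℕ)
  (hM : ∀ (x : SiteZ d) (μ ν : Fin d), l1 (x - y) ≤ R → ‖asum A x (plaqWord μ ν)‖ ≤ M)
include hM0 hM

/-- ★★ **`‖A(Γ^σ_{y,x}) − A(Γ_{y,x})‖ ≤ |x − y|₁²·M`** for EVERY ordering `σ` of [Balaban1987RG1] (0.3), `M` a bound of the plaquette curls within `|x − y|₁ ≤ R` of `y`: the σ-staircase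
and the tree staircase of [Balaban1984PropagatorsI] (1.7) run through permuted axis lists with the same runs, so they differ by a flat Stokes sum over at most `|x − y|₁²` plaquettes.
[cite: Balaban1987RG1, (0.3) p.252; Balaban1984PropagatorsI, (1.7) p.18; Balaban1985Averaging, (48)–(50) pp.24–25] -/
theorem norm_asum_stairWord_sub_treeWord_le (n : SiteZ d) (hn : l1 n ≤ R) (σ : Equiv.Perm (Fin d)) :
    ‖asum A y (stairWord σ n) - asum A y (treeWord n)‖ ≤ l1 n * l1 n * M := by
  rw [stairWord_eq_tw, treeWord_eq_tw]
  have hperm : ((List.finRange d).map σ).Perm (List.finRange d).reverse :=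
    (Equiv.Perm.map_finRange_perm σ).trans (List.reverse_perm _).symm
  have h0 : l1 (y - y) = 0 := by simp [l1]
  have h := norm_asum_tw_perm_le A hM0 y R hM n _ _ y hperm (by rw [runLen_finRange_map, h0]; simpa using hn)
  rwa [runLen_finRange_map] at h

variable [NormedAlgebra ℂ 𝔸] (L : ℕ)

omit hM0 hM in
/-- `Φ_A(y) = Σ_i |IdxZ|⁻¹·[A(Γ^σ_{y,x}) − A(Γ_{y,x})]` — the flat carried letter as a mean of staircase differences (`PhiZ = SZ − FhatZ` with the tree frame re-indexed over the loop family).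
[cite: Balaban1987RG1, (0.3)–(0.4) pp.252–253; Balaban1985Averaging, (112) p.34] -/
theorem PhiZ_eq_mean (hL : 1 ≤ L) (q : SiteZ d) :
    PhiZ L A q = ∑ i : IdxZ d L, ((Fintype.card (IdxZ d L) : ℝ))⁻¹ •
      (asum A q (stairWord i.2.1 (offZ L i.1)) - asum A q (treeWord (offZ L i.1))) := by
  unfold PhiZ SZ FhatZ
  rw [← sum_IdxZ_fst L hL (fun r => asum A q (treeWord (offZ L r)))]
  simp only [smul_sub, Finset.sum_sub_distrib]

/-- ★★★ **THE CURVATURE BOUND OF THE FLAT CARRIED LETTER: `‖Φ_A(y)‖ ≤ (d·s)²·M`** on centred blocks of side `L = 2s + 1` (`|x − y|₁ ≤ d·s` for every block point), `M` a bound of the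
plaquette curls `‖A(∂p)‖` within `|·|₁`-distance `R ≥ d·s` of the block centre `y` — the «N2 estimate proper» of road (A′) at the flat background: the carried gauge letter is controlled by
the CURVATURE of `A` on the block, not by `sup|A|`. [cite: Balaban1987RG1, (0.3)–(0.4) pp.252–253; Balaban1985Averaging, (112) p.34, (124)–(126) p.36] -/
theorem norm_PhiZ_le {s : ℕ} (hL : L = 2 * s + 1) (hR : d * s ≤ R) : ‖PhiZ L A y‖ ≤ ((d : ℝ) * s) ^ 2 * M := by
  have hL1 : 1 ≤ L := by omega
  rw [PhiZ_eq_mean A L hL1]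
  refine norm_avgZ_le L hL1 _ fun i => ?_
  refine (norm_asum_stairWord_sub_treeWord_le A hM0 y R hM _ ((l1_offZ_le hL i.1).trans hR) _).trans ?_
  have h1 : (l1 (offZ L i.1) : ℝ) ≤ d * s := by exact_mod_cast l1_offZ_le hL i.1
  have h0 : (0 : ℝ) ≤ l1 (offZ L i.1) := by positivity
  calc (l1 (offZ L i.1) : ℝ) * l1 (offZ L i.1) * M ≤ ((d : ℝ) * s) * ((d : ℝ) * s) * M := by gcongr
    _ = ((d : ℝ) * s) ^ 2 * M := by ring

end Phi

section PhiGlobal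

variable [NormedAlgebra ℂ 𝔸] (L : ℕ) (A : SiteZ d → Fin d → 𝔸) {M : ℝ} (hM0 : 0 ≤ M)
  (hM : ∀ (x : SiteZ d) (μ ν : Fin d), ‖asum A x (plaqWord μ ν)‖ ≤ M)
include hM0 hM

/-- The curvature bound with a GLOBAL plaquette bound (the engine lineage's (52)-style hypothesis): `‖Φ_A(y)‖ ≤ (d·s)²·M` at every `y`. [cite: Balaban1985Averaging, (52) p.26, (124)–(126) p.36; Balaban1987RG1, (0.4) p.253] -/
theorem norm_PhiZ_le_global {s : ℕ} (hL : L = 2 * s + 1) (q : SiteZ d) : ‖PhiZ L A q‖ ≤ ((d : ℝ) * s) ^ 2 * M :=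
  norm_PhiZ_le A hM0 q (d * s) (fun x μ ν _ => hM x μ ν) L hL le_rfl

/-- **THE FLAT CARRIED GAUGE TERM OF ONE `L`-BOND: `‖Φ_A(c₋) − Φ_A(c₊)‖ ≤ 2(d·s)²·M`** — the amount by which «L(Q(1)A)_c» differs from print's straight block average `L·(Q₀A)_c`
(`B7Prop3GaugeCarryRec.linQcovZ_one_left`), bounded by the curvature of `A`. [cite: Balaban1985Averaging, (122) p.36, (125)–(126) p.36; Balaban1987RG1, (0.4) p.253] -/
theorem norm_PhiZ_sub_le {s : ℕ} (hL : L = 2 * s + 1) (q : SiteZ d) (κ : Fin d) :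
    ‖PhiZ L A q - PhiZ L A (q + (L : ℤ) • e κ)‖ ≤ 2 * ((d : ℝ) * s) ^ 2 * M :=
  (norm_sub_le _ _).trans (by linarith [norm_PhiZ_le_global L A hM0 hM hL q, norm_PhiZ_le_global L A hM0 hM hL (q + (L : ℤ) • e κ)])

end PhiGlobal

end Literature.MathematicalPhysics.QuantumFieldTheory.Balaban1983to89.B7Prop3StaircaseStokesRec
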